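import Literature.NumberTheory.EllipticCurves.PAdicLFunctionQuadraticTwistCongruenceAtTwoPeriodProofs
import Literature.NumberTheory.EllipticCurves.PAdicLFunctionQuadraticTwistBirchSharedPrimesProofs
import Literature.NumberTheory.EllipticCurves.PAdicLFunctionTameDepletionCongruenceAtTwoSharedPrimesProofs
import HarnessLib

/-!
# The mod-`2` twist congruence `L₂(f_{E^{(d)}}) ≡ v·L₂(f_E)·∏_{ℓ∣d}𝒫_ℓ (mod 2Λ)` with the period size of Birch's constant,
# for `d` MEETING `N_E` AT MULTIPLICATIVE PRIMES (Matsuno 2000, proof of Thm. 3.1 at `p = 2`; PROOFS ONLY)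

A *proofs* file (theorems only: no definition, no named fact, no axiom). It is the companion of
`PAdicLFunctionQuadraticTwistCongruenceAtTwoProofs` / `…PeriodProofs` (`exists_iwasawa_twist_congr_two[_and_sq]`, which
assume `(d, N_E) = 1`): for `E = W/ℚ` globally minimal and good ordinary at `2`, `d > 0`, `d ≡ 1 (mod 4)` square-free with
`E` GOOD OR MULTIPLICATIVE at every prime of `d`, `A` a globally minimal model of `E^{(d)}`, newforms `f_W`, `f_A`, and `S₀` the
places over the primes of `d`:

* `exists_ratPlusSymbol_twist_eq_sum_and_sq_sqfreeAt` — Birch's lemma for `(f_W, f_A)` WITH the period identity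
  `c²·d·(Ω⁺_{f_A})² = (Ω⁺_{f_W})²` (`g(χ_d)² = d`; `isNewformOf_twist_eq_charTwist_sqfreeAt`);
* `exists_padicLFunction_twist_eq_C_mul_padicLFunctionTame_and_sq_sqfreeAt` — the transform identity
  `L_p(f_A, α_A) = C(c)·(1+T)^{−f_m}·L_p(f_W, m, α_W, χ_d)` with `c ≠ 0` and the period identity;
* **`exists_iwasawa_twist_congr_two_sqfreeAt`**, **`exists_iwasawa_twist_congr_two_and_sq_sqfreeAt`** — there are
  `L_W, L_A' ∈ Λ`, `c_A ∈ ℚˣ`, `v ∈ Λˣ` with `ι L_W = L₂(f_W, α_W)`, `ι L_A' = C(c_A)·L₂(f_A, α_A)`,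
  `L_A' ≡ v · L_W · ∏_{v∈S₀} 𝒫_v (mod 2Λ)` [and `d·(Ω⁺_{f_A})² = c_A²·(Ω⁺_{f_W})²`] — Birch (`…BirchSharedPrimesProofs`) +
  the tame congruence at a level whose places are good or multiplicative
  (`exists_iwasawa_padicLFunctionTame_congr_two_sqfreeAt`).

At the multiplicative places `𝒫_v = 1 ∓ ℓ⁻¹(1+T)^{f_ℓ}` has `μ = 0` and `λ(𝒫_v) = 2^{v₂(f_ℓ)}`, the number of primes of `ℚ_∞` over
`ℓ` — Matsuno 2008's local term `d̄_{E,ℓ} = 1` of the algebraic Kida formula (`matsuno2008_thm42_transport_two_twist`). Cell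
bsd-2adic, seat conv-1 GEN 16 (the analytic half of the S3 twist road without coprimality at multiplicative primes).

## References

* K. Matsuno, J. Number Theory 84 (2000) 80–92, Lemmas 3.2–3.3 and proof of Thm. 3.1 (pp. 86–88). [Matsuno2000]
* B. Mazur, J. Tate, J. Teitelbaum, Invent. Math. 84 (1986), §I.8, §I.11–I.13. [MazurTateTeitelbaum1986Invent]
* G. Shimura, *Introduction to the arithmetic theory of automorphic functions* (1971), Prop. 3.64. [Shimura1971]
* R. Greenberg, V. Vatsal, Invent. Math. 142 (2000), §2 Prop. (2.4). [GreenbergVatsal2000]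
-/

noncomputable section

open scoped Classical MatrixGroups ModularForm NumberTheorySymbols

open CongruenceSubgroup NumberField IsDedekindDomain WeierstrassCurve PowerSeries Rat.HeightOneSpectrum
  Literature.NumberTheory.EllipticCurves.ModularForms Literature.NumberTheory.EllipticCurves.GreenbergVatsal2000

namespace Literature.NumberTheory.EllipticCurves

/-! ## §1. Birch's lemma WITH the period identity, `d` meeting `N_E` at multiplicative primes -/

section Period

variable (W : WeierstrassCurve ℚ) [W.IsElliptic] [W.IsGloballyMinimal] {d : ℤ} {A : WeierstrassCurve ℚ}
  [A.IsElliptic] [A.IsGloballyMinimal] {p : ℕ} [Fact p.Prime]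
  [NeZero (W.conductorNorm ℤ)] [NeZero (A.conductorNorm ℤ)] [NeZero d.natAbs]
  {fW : CuspForm (Gamma0 (W.conductorNorm ℤ)) 2} {fA : CuspForm (Gamma0 (A.conductorNorm ℤ)) 2}

omit [A.IsElliptic] [A.IsGloballyMinimal] [Fact p.Prime] in
/-- **Birch's lemma for `(f_W, f_A)` WITH the period constant, WITHOUT `(d, N_E) = 1`.** For `d > 0`, `d ≡ 1 (mod 4)` square-free,
`E` good or multiplicative at the primes of `d`, `A` a model of `E^{(d)}` and the newforms `f_W`, `f_A`: there is ONE `c ∈ ℚ` with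
`[x]⁺_{f_A} = c · Σ_{b mod d} χ_d(b) · [x + b/d]⁺_{f_W}` for every `x`, and, as soon as some `[x]⁺_{f_A} ≠ 0`,
`c² · d · (Ω⁺_{f_A})² = (Ω⁺_{f_W})²` (the tree's `exists_rat_forall_ratPlusSymbol_charTwist_eq` along
`f_A = charTwist N_A f_W`, `isNewformOf_twist_eq_charTwist_sqfreeAt`, squared with `g(χ_d)² = d`). The companion of
`exists_ratPlusSymbol_twist_eq_sum_and_sq`. [cite: MazurTateTeitelbaum1986Invent, §I.8] [cite: Shimura1971, Prop. 3.64] -/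
theorem exists_ratPlusSymbol_twist_eq_sum_and_sq_sqfreeAt (hd : 0 < d) (hd4 : d % 4 = 1) (hsq : Squarefree d)
    (hred : ∀ v : HeightOneSpectrum (𝓞 ℚ), ((primesEquiv v : ℕ) : ℤ) ∣ d →
      W.HasGoodReductionAt v ∨ W.HasMultiplicativeReductionAt v)
    {C : VariableChange ℚ} (hA : C • W.quadraticTwist (d : ℚ) = A) (hfW : IsNewformOf W fW) (hfA : IsNewformOf A fA)
    {χ : MulChar (ZMod d.natAbs) ℤ} (hχ : ∀ a : ZMod d.natAbs, χ a = J((a.val : ℤ) | d.natAbs)) :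
    ∃ c : ℚ, (∀ x : ℚ, ratPlusSymbol fA x =
        c * ∑ b : ZMod d.natAbs, (χ.ringHomComp (Int.castRingHom ℚ)) b * ratPlusSymbol fW (x + (b.val : ℚ) / d.natAbs)) ∧
      ((∃ x : ℚ, ratPlusSymbol fA x ≠ 0) → (c : ℝ) ^ 2 * (d : ℝ) * plusPeriod fA ^ 2 = plusPeriod fW ^ 2) := by
  have hmd : (d.natAbs : ℤ) = d := Int.natAbs_of_nonneg hd.le
  have hodd : Odd d.natAbs := Int.natAbs_odd.mpr (Int.odd_iff.mpr (by omega))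
  have hsq' : Squarefree d.natAbs := Int.squarefree_natAbs.mpr hsq
  have hm4 : d.natAbs % 4 = 1 := by omega
  obtain ⟨hq, hprim⟩ := mulChar_jacobi_complex_isQuadratic_isPrimitive hχ hodd hsq'
  have heven : DirichletCharacter.Even (χ.ringHomComp (Int.castRingHom ℂ)) := by
    show (χ.ringHomComp (Int.castRingHom ℂ)) (-1) = 1
    rw [MulChar.ringHomComp_apply, mulChar_jacobi_apply_neg_one hχ hm4, map_one]
  have hg2 := gaussSum_jacobi_sq_eq hd hd4 hsq hχ
  obtain ⟨hN, hm, -⟩ := conductorNorm_twist_dvd_sqfreeAt W hd4 hsq hred hA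
  have hFA := isNewformOf_twist_eq_charTwist_sqfreeAt W hd4 hsq hred hA hfW hfA hχ hq hprim hN hm
  subst hFA
  obtain ⟨c, hc, hper⟩ := exists_rat_forall_ratPlusSymbol_charTwist_eq (A.conductorNorm ℤ) hN hm hq heven hprim
    hfW.1 hfW.coeffField_eq_bot hfA.1 hfA.coeffField_eq_bot (fun u ↦ J((u.val : ℤ) | d.natAbs))
    (fun u ↦ by rw [MulChar.ringHomComp_apply, hχ, eq_intCast])
  have hsum : ∀ x : ℚ, ∑ b : ZMod d.natAbs, (χ.ringHomComp (Int.castRingHom ℚ)) b *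
      ratPlusSymbol fW (x + (b.val : ℚ) / d.natAbs) =
      ∑ u : ZMod d.natAbs, (J((u.val : ℤ) | d.natAbs) : ℚ) * ratPlusSymbol fW (x + twistShift u) := by
    intro x
    refine Finset.sum_congr rfl fun b _ ↦ ?_
    rw [MulChar.ringHomComp_apply, hχ, eq_intCast]
    rfl
  refine ⟨c, fun x ↦ by rw [hc x, hsum x], fun ⟨x, hx⟩ ↦ ?_⟩
  have hS : ∃ r : ℚ, ∑ u : ZMod d.natAbs, (J((u.val : ℤ) | d.natAbs) : ℚ) * ratPlusSymbol fW (r + twistShift u) ≠ 0 := by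
    refine ⟨x, fun h0 ↦ hx ?_⟩
    rw [hc x, h0, mul_zero]
  have hP := hper hS
  have hsqP := congrArg (fun z : ℂ ↦ z ^ 2) hP
  rw [mul_pow, mul_pow, hg2] at hsqP
  have hdZ : ((d.natAbs : ℤ) : ℂ) = (d : ℂ) := congrArg (Int.cast : ℤ → ℂ) hmd
  have hdC : ((d.natAbs : ℕ) : ℂ) = (d : ℂ) := by rw [← hdZ, Int.cast_natCast]
  rw [hdC] at hsqP
  apply Complex.ofReal_injective
  push_cast
  linear_combination hsqP

/-- **Birch's lemma for the `p`-adic `L`-function of the quadratic twist WITH the period size of the constant, WITHOUT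
`(d, N_E) = 1`** (`p ∤ d` a good ordinary prime of `E`; `E` good or multiplicative at the primes of `d`): for some `c ∈ ℚˣ`,
`L_p(f_A, α_A, T) = C(c) · (1+T)^{−f_m} · L_p(f_W, m, α_W, χ_d, T)` AND `c² · d · (Ω⁺_{f_A})² = (Ω⁺_{f_W})²`. The companion of
`exists_padicLFunction_twist_eq_C_mul_padicLFunctionTame_and_sq`. [cite: MazurTateTeitelbaum1986Invent, §I.8 and §I.11–I.13]
[cite: Matsuno2000, §2 (p. 84)] -/
theorem exists_padicLFunction_twist_eq_C_mul_padicLFunctionTame_and_sq_sqfreeAt (hd : 0 < d) (hd4 : d % 4 = 1)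
    (hsq : Squarefree d)
    (hred : ∀ v : HeightOneSpectrum (𝓞 ℚ), ((primesEquiv v : ℕ) : ℤ) ∣ d →
      W.HasGoodReductionAt v ∨ W.HasMultiplicativeReductionAt v)
    {C : VariableChange ℚ} (hA : C • W.quadraticTwist (d : ℚ) = A) (hfW : IsNewformOf W fW) (hfA : IsNewformOf A fA)
    (hord : IsOrdinaryAt W p) (hpd : ¬ (p : ℤ) ∣ d)
    {χ : MulChar (ZMod d.natAbs) ℤ} (hχ : ∀ a : ZMod d.natAbs, χ a = J((a.val : ℤ) | d.natAbs)) :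
    ∃ c : ℚ, c ≠ 0 ∧ padicLFunction fA (unitRoot A p : ℚ_[p]) =
      PowerSeries.C (c : ℚ_[p]) * PowerSeries.binomialSeries ℚ_[p] (-frobeniusExponent p (d.natAbs : ℤ_[p])) *
        padicLFunctionTame fW d.natAbs (unitRoot W p : ℚ_[p])
          ((χ.ringHomComp (Int.castRingHom ℚ)).ringHomComp (Rat.castHom ℚ_[p])) ∧
      (c : ℝ) ^ 2 * (d : ℝ) * plusPeriod fA ^ 2 = plusPeriod fW ^ 2 := by
  have hp : p.Prime := Fact.out
  obtain ⟨c, hB, hper⟩ := exists_ratPlusSymbol_twist_eq_sum_and_sq_sqfreeAt W hd hd4 hsq hred hA hfW hfA hχ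
  have hxA : ∃ x : ℚ, ratPlusSymbol fA x ≠ 0 := exists_ratPlusSymbol_ne_zero hfA.1 hfA.coeffField_eq_bot
  have hc0 : c ≠ 0 := by
    rintro rfl
    obtain ⟨x, hx⟩ := hxA
    exact hx (by rw [hB x, zero_mul])
  obtain ⟨hordA, hαA⟩ := isOrdinaryAt_twist_and_unitRoot_eq_sqfreeAt W p hd4 hsq hred hA hord hpd
  obtain ⟨hαeq, hαu, -⟩ := unitRoot_coe_spec (W := W) hord
  have hpN : ¬ p ∣ W.conductorNorm ℤ := not_dvd_level_of_isNewformOf hfW hord.1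
  have hpm : ¬ p ∣ d.natAbs := fun h ↦ hpd (Int.natCast_dvd.mpr h)
  have hmp : d.natAbs.Coprime p := Nat.coprime_comm.mp ((Nat.Prime.coprime_iff_not_dvd hp).mpr hpm)
  have hap : cuspCoeff fW p = ((W.frobeniusTrace p : ℤ) : ℂ) :=
    cuspCoeff_eq_frobeniusTrace_of_isNewformOf_holds hfW hord.1
  have hχp : (χ.ringHomComp (Int.castRingHom ℚ)) (p : ZMod d.natAbs) ^ 2 = 1 := by
    rw [MulChar.ringHomComp_apply, ← map_pow, mulChar_jacobi_apply_natCast_sq hχ p hmp.symm, map_one]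
  have key := padicLFunction_twist_eq_of_birch fW fA hfW.1 hfW.coeffField_eq_bot hpN hmp hap hαeq hαu
    (χ.ringHomComp (Int.castRingHom ℚ)) hχp hB
  have hαA' : (unitRoot A p : ℚ_[p]) =
      (((χ.ringHomComp (Int.castRingHom ℚ)) (p : ZMod d.natAbs) : ℚ) : ℚ_[p]) * (unitRoot W p : ℚ_[p]) := by
    rw [hαA, MulChar.ringHomComp_apply, mulChar_jacobi_apply_natCast hχ p, eq_intCast]
    push_cast
    rfl
  exact ⟨c, hc0, by rw [hαA']; exact key, hper hxA⟩

end Period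

/-! ## §2. The mod-`2` twist congruence, `d` meeting `N_E` at multiplicative primes -/

section TwoAdic

variable (W : WeierstrassCurve ℚ) [W.IsElliptic] [W.IsGloballyMinimal] {d : ℤ} {A : WeierstrassCurve ℚ}
  [A.IsElliptic] [A.IsGloballyMinimal]
  [NeZero (W.conductorNorm ℤ)] [NeZero (A.conductorNorm ℤ)]
  {fW : CuspForm (Gamma0 (W.conductorNorm ℤ)) 2} {fA : CuspForm (Gamma0 (A.conductorNorm ℤ)) 2}

omit [W.IsElliptic] [W.IsGloballyMinimal] [NeZero (W.conductorNorm ℤ)] in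
/-- Distinct finite places of `ℚ` lie over distinct primes; private helper. [folklore] -/
private theorem natGenerator_injective_rat_sp :
    Function.Injective (Rat.HeightOneSpectrum.natGenerator (R := 𝓞 ℚ)) := fun _ _ h ↦
  (Rat.HeightOneSpectrum.primesEquiv (R := 𝓞 ℚ)).injective (Subtype.ext h)

/-- **The mod-`2` twist congruence WITH the period size of the constant, WITHOUT `(d, N_E) = 1`** (Matsuno 2000, proof of
Thm. 3.1 at `p = 2`, with Birch's lemma): for `E = W/ℚ` globally minimal, good ordinary at `2` (no hypothesis on `E[2]`),
`d > 0`, `d ≡ 1 (mod 4)` square-free with `E` GOOD OR MULTIPLICATIVE at every prime of `d`, `A` a globally minimal model of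
`E^{(d)}`, newforms `f_W`, `f_A`, and `S₀` the set of places over the primes dividing `d`: there are `L_W, L_A' ∈ Λ = ℤ₂⟦T⟧`,
`c_A ∈ ℚˣ` and `v ∈ Λˣ` with `ι L_W = L₂(f_W, α_W)`, `ι L_A' = C(c_A)·L₂(f_A, α_A)`,
`L_A' ≡ v · L_W · ∏_{v∈S₀} 𝒫_v (mod 2Λ)` (`𝒫_v` = Greenberg–Vatsal's Euler factor, `1 ∓ ℓ⁻¹(1+T)^{f_ℓ}` at the multiplicative
places), AND `d · (Ω⁺_{f_A})² = c_A² · (Ω⁺_{f_W})²`. The companion of `exists_iwasawa_twist_congr_two_and_sq`.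
[cite: Matsuno2000, Lemmas 3.2–3.3 and proof of Theorem 3.1 (pp. 86–88)] [cite: MazurTateTeitelbaum1986Invent, §I.8] -/
theorem exists_iwasawa_twist_congr_two_and_sq_sqfreeAt (hd : 0 < d) (hd4 : d % 4 = 1) (hsq : Squarefree d)
    (hred : ∀ v : HeightOneSpectrum (𝓞 ℚ), ((primesEquiv v : ℕ) : ℤ) ∣ d →
      W.HasGoodReductionAt v ∨ W.HasMultiplicativeReductionAt v)
    {C : VariableChange ℚ} (hA : C • W.quadraticTwist (d : ℚ) = A) (hfW : IsNewformOf W fW) (hfA : IsNewformOf A fA)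
    (hord : IsOrdinaryAt W 2) (S₀ : Finset (HeightOneSpectrum (𝓞 ℚ)))
    (hS₀ : S₀.image Rat.HeightOneSpectrum.natGenerator = d.natAbs.primeFactors) :
    ∃ (LW LA' : IwasawaAlgebra 2) (cA : ℚ) (v : (IwasawaAlgebra 2)ˣ),
      iwasawaToPowerSeries 2 LW = padicLFunction fW (unitRoot W 2 : ℚ_[2]) ∧ cA ≠ 0 ∧
      iwasawaToPowerSeries 2 LA' = PowerSeries.C (cA : ℚ_[2]) * padicLFunction fA (unitRoot A 2 : ℚ_[2]) ∧
      PowerSeries.map (PadicInt.toZMod (p := 2)) LA' =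
        PowerSeries.map (PadicInt.toZMod (p := 2)) ((v : IwasawaAlgebra 2) * LW * eulerFactorProduct W 2 S₀) ∧
      (d : ℝ) * plusPeriod fA ^ 2 = (cA : ℝ) ^ 2 * plusPeriod fW ^ 2 := by
  have hd0 : d ≠ 0 := hd.ne'
  haveI : NeZero d.natAbs := ⟨Int.natAbs_ne_zero.mpr hd0⟩
  have hsq' : Squarefree d.natAbs := Int.squarefree_natAbs.mpr hsq
  have hm4 : d.natAbs % 4 = 1 := by omega
  have hd2 : ¬ (2 : ℤ) ∣ d := by omega
  obtain ⟨χ, hχ⟩ := exists_mulChar_int_eq_jacobiSym d.natAbs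
  obtain ⟨c, hc0, hL, hper⟩ :=
    exists_padicLFunction_twist_eq_C_mul_padicLFunctionTame_and_sq_sqfreeAt W hd hd4 hsq hred hA hfW hfA hord hd2 hχ
  set χ₂ : DirichletCharacter ℚ_[2] d.natAbs :=
    (χ.ringHomComp (Int.castRingHom ℚ)).ringHomComp (Rat.castHom ℚ_[2]) with hχ₂_def
  have hχ₂even : χ₂.Even := by
    show χ₂ (-1) = 1
    rw [hχ₂_def, MulChar.ringHomComp_apply, MulChar.ringHomComp_apply, mulChar_jacobi_apply_neg_one hχ hm4, map_one,
      map_one]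
  have hχ₂sq : χ₂ ^ 2 = 1 := by
    have : χ₂ = χ.ringHomComp ((Rat.castHom ℚ_[2]).comp (Int.castRingHom ℚ)) := MulChar.ext' fun a ↦ rfl
    rw [this]
    exact mulChar_jacobi_ringHomComp_sq hχ _
  -- the places over the primes of `d`: odd, and good or multiplicative for `E`
  have hS2 : ∀ v ∈ S₀, Rat.HeightOneSpectrum.natGenerator v ≠ 2 := by
    intro v hv h
    have hmem : Rat.HeightOneSpectrum.natGenerator v ∈ d.natAbs.primeFactors := hS₀ ▸ Finset.mem_image_of_mem _ hv
    rw [h] at hmem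
    exact hd2 (Int.natCast_dvd.mpr (Nat.dvd_of_mem_primeFactors hmem))
  have hredS : ∀ v ∈ S₀, W.HasGoodReductionAt v ∨ W.HasMultiplicativeReductionAt v := by
    intro v hv
    have hmem : Rat.HeightOneSpectrum.natGenerator v ∈ d.natAbs.primeFactors := hS₀ ▸ Finset.mem_image_of_mem _ hv
    exact hred v (Int.natCast_dvd.mpr (Nat.dvd_of_mem_primeFactors hmem))
  have hm : d.natAbs = ∏ v ∈ S₀, Rat.HeightOneSpectrum.natGenerator v := by
    have h := Nat.prod_primeFactors_of_squarefree hsq'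
    rw [← hS₀, Finset.prod_image fun v _ w _ h ↦ natGenerator_injective_rat_sp h] at h
    exact h.symm
  obtain ⟨LW, G, u, hLW, hG, hGc⟩ :=
    exists_iwasawa_padicLFunctionTame_congr_two_sqfreeAt hord hfW S₀ hS2 hredS hm χ₂ hχ₂even hχ₂sq
  -- the unit `(1+T)^{−f_m}` of `Λ`
  set B : IwasawaAlgebra 2 := PowerSeries.binomialSeries ℤ_[2] (-frobeniusExponent 2 (d.natAbs : ℤ_[2])) with hB
  have hBu : IsUnit B :=
    isUnit_iff_exists_inv.mpr ⟨PowerSeries.binomialSeries ℤ_[2] (frobeniusExponent 2 (d.natAbs : ℤ_[2])), by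
      rw [hB, ← PowerSeries.binomialSeries_add, neg_add_cancel, PowerSeries.binomialSeries_zero]⟩
  have hcQ : (c : ℚ_[2]) ≠ 0 := by exact_mod_cast hc0
  have hperiod : (d : ℝ) * plusPeriod fA ^ 2 = ((c⁻¹ : ℚ) : ℝ) ^ 2 * plusPeriod fW ^ 2 := by
    have hcR : (c : ℝ) ≠ 0 := by exact_mod_cast hc0
    rw [← hper]
    push_cast
    field_simp
  refine ⟨LW, B * G, c⁻¹, hBu.unit * u, hLW, inv_ne_zero hc0, ?_, ?_, hperiod⟩
  · rw [map_mul, hG, hB, BurungaleSkinner2023.iwasawaToPowerSeries_binomialSeries, hL, Rat.cast_inv, ← mul_assoc,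
      ← mul_assoc, ← map_mul, inv_mul_cancel₀ hcQ, map_one, one_mul]
  · rw [map_mul, hGc, ← map_mul, Units.val_mul, IsUnit.unit_spec]
    congr 1
    ring

/-- **The mod-`2` twist congruence WITHOUT `(d, N_E) = 1`** (period clause dropped): under the hypotheses of
`exists_iwasawa_twist_congr_two_and_sq_sqfreeAt` there are `L_W, L_A' ∈ Λ`, `c_A ∈ ℚˣ`, `v ∈ Λˣ` with `ι L_W = L₂(f_W, α_W)`,
`ι L_A' = C(c_A)·L₂(f_A, α_A)` and `L_A' ≡ v · L_W · ∏_{v∈S₀} 𝒫_v (mod 2Λ)`. The companion of `exists_iwasawa_twist_congr_two`.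
[cite: Matsuno2000, Lemmas 3.2–3.3 and proof of Theorem 3.1 (pp. 86–88)] [cite: MazurTateTeitelbaum1986Invent, §I.8] -/
theorem exists_iwasawa_twist_congr_two_sqfreeAt (hd : 0 < d) (hd4 : d % 4 = 1) (hsq : Squarefree d)
    (hred : ∀ v : HeightOneSpectrum (𝓞 ℚ), ((primesEquiv v : ℕ) : ℤ) ∣ d →
      W.HasGoodReductionAt v ∨ W.HasMultiplicativeReductionAt v)
    {C : VariableChange ℚ} (hA : C • W.quadraticTwist (d : ℚ) = A) (hfW : IsNewformOf W fW) (hfA : IsNewformOf A fA)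
    (hord : IsOrdinaryAt W 2) (S₀ : Finset (HeightOneSpectrum (𝓞 ℚ)))
    (hS₀ : S₀.image Rat.HeightOneSpectrum.natGenerator = d.natAbs.primeFactors) :
    ∃ (LW LA' : IwasawaAlgebra 2) (cA : ℚ) (v : (IwasawaAlgebra 2)ˣ),
      iwasawaToPowerSeries 2 LW = padicLFunction fW (unitRoot W 2 : ℚ_[2]) ∧ cA ≠ 0 ∧
      iwasawaToPowerSeries 2 LA' = PowerSeries.C (cA : ℚ_[2]) * padicLFunction fA (unitRoot A 2 : ℚ_[2]) ∧
      PowerSeries.map (PadicInt.toZMod (p := 2)) LA' =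
        PowerSeries.map (PadicInt.toZMod (p := 2)) ((v : IwasawaAlgebra 2) * LW * eulerFactorProduct W 2 S₀) := by
  obtain ⟨LW, LA', cA, v, h1, h2, h3, h4, -⟩ :=
    exists_iwasawa_twist_congr_two_and_sq_sqfreeAt W hd hd4 hsq hred hA hfW hfA hord S₀ hS₀
  exact ⟨LW, LA', cA, v, h1, h2, h3, h4⟩

end TwoAdic

end Literature.NumberTheory.EllipticCurves

end
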